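import Literature.IUT.HodgeArakelov.MonoThetaProjectiveThetaEnvProofs
import Literature.IUT.HodgeArakelov.MonoThetaProjectiveBridgeEtThTower
import Literature.IUT.HodgeArakelov.EtaleThetaDataOfSettingCor218i
import Literature.IUT.HodgeArakelov.ModelCyclotomesZHat
import Literature.AnabelianGeometry.EtaleTheta.Discharge.Sec2Cor218ivAllLevels

/-!
# [IUTchII] Prop. 1.5 (ii)+(iii) for the natural system of the genuine [EtTh] model, modulo the FACT-LIST
# inputs of the [EtTh] Cor. 2.19 (ii) model discharge (proof-only capstone)

Proof-only companion (abc-iut cell; seat abc-iut-L2-t10, gen 3, layer L2 [EtTh]; DAG node **IUTchII:Prop1.5(iii)**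
(+ (ii)), holder abc-iut-w4-d030 — written at the holder's invitation, INBOX 2026-08-26T01:38:38Z) of
abc-iut-w4-d030's `MonoThetaProjectiveThetaEnvProofs.lean` (`EtaleLevels.prop15_ii_iii_modelSystem_of_cor218_i'`,
`EtaleLevels.nonempty_thetaEnvData`, `EtaleLevels.bijective_rigidLimHom`). NO definition, NO new named fact.

Sources: S. Mochizuki, *Inter-universal Teichmüller theory II*, kurims manuscript (Dec. 2020), Prop. 1.5 (ii), (iii)
pp. 29–30 [claim: Mochizuki2012, status: disputed] (IUTchII §1 Prop 1.5 (iii), kurims pp.29-30); S. Mochizuki, *The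
étale theta function …*, Publ. RIMS **45** (2009), Cor. 2.18 (i), (iv) pp. 286–289, Cor. 2.19 (ii), (iii)
pp. 290–292 [cite: MochizukiEtTh2009, Cor 2.18(iv) p.61].

WHAT IS PROVED. `prop15_ii_iii_modelSystem_of_cor218_i'` takes, BY NAME, [EtTh] Cor. 2.18 (i) for abc-iut-L2-t8's
instantiated rigidity data at every level `mods M` and [EtTh] Cor. 2.18 (iv) surjectivity
(`ThetaEnvData.Cor218_iv_surjective`, FACT-LIST F-0639) at every level; the natural system itself takes `hZ`
("`(l·Δ_Θ)(M) ≅ Ẑ`", GAP-LEDGER G-w4d021-1). For the levels `τ.modAll M` of ONE compatible cyclotome tower `τ`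
over a cofinal chain `E ∋ 1`, layer L2 supplies all three: Cor. 2.18 (i) is level-free
(`DoubleUnderline.rigidData_cor218_i_of_level`), Cor. 2.18 (iv) surjectivity at EVERY `M ∈ ℕ≥1` is
`DoubleUnderline.thetaEnvData_cor218_iv_surjective_modAll` (⟸ Cor. 2.18 (i) at the chain levels +
`ThetaEnvTower.Cor219_iii` + Prop. 1.5 (ii), (iii); `Discharge/Sec2Cor218ivAllLevels.lean`), and `hZ` is
abc-iut-L2-d1's `ModelCyclotomes.nonempty_lDeltaQuot_rigidData_mulEquiv_zHat` (⟸ `IsEtThOrigin`, `hYcl`). Hence: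
* `prop15_ii_iii_modelSystem_of_facts` — Prop. 1.5 (ii)+(iii) for the natural system (any `hZ`), modulo Prop. 1.5
  (ii), (iii), `L`, Cor. 2.18 (i) at the chain levels, `ThetaEnvTower.Cor219_iii`;
* `prop15_ii_iii_modelSystem_of_origin` — the same with `hZ` from `IsEtThOrigin`, `hYcl`;
* `nonempty_thetaEnvData_of_origin` — Prop. 1.5 (iii) alone (the `θ_env` data EXIST) modulo Prop. 1.5 (iii), `L`,
  Cor. 2.18 (i) at one chain level, `IsEtThOrigin`, `hYcl`.
With `MonoThetaProjectiveBridgeEtThFacts.lean` ((i), (i)′, (ii)) the whole of [IUTchII] Prop. 1.5 (i)–(iii) at the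
genuine models carries ONLY {Prop15ii, Prop15iii, L, IsSlimGroup D.PiTemp, IsOpenMap D.aug, ∀e Cor218_i,
ThetaEnvTower.Cor219_iii, IsEtThOrigin, hYcl} — abc-iut-L2-d1's [EtTh] Cor. 2.19 (ii) census. HONEST FRAMING:
conditional discharge modulo the inputs listed, which are NOT asserted; the [IUTchII] claim key `Mochizuki2012` is
DISPUTED (D-0012); no side is taken on [IUTchIII] Cor. 3.12; typed ≠ discharged.

v2 (seat abc-iut-L2-t10, gen 4; APPEND — the three theorems above byte-identical):
* `cor218_i_modAll_of_chain` — [EtTh] Cor. 2.18 (i) at EVERY `τ.modAll M` from the single chain level `1 ∈ E`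
  (the named form of the transport used inline above; the hypothesis `h218i` of
  `prop15_ii_iii_modelSystem_of_cor218_i'` / `transitionsAreIsos_modelSystem_of_cor218_i`);
* `prop15_i_i'_ii_iii_modelSystem_of_origin` — **the whole node IUTchII:Prop1.5 (i) (printed form), (i)′, (ii), (iii)
  at the genuine models under ONE binder list** {Prop15ii, Prop15iii, L, IsSlimGroup D.PiTemp, IsOpenMap D.aug,
  ∀e Cor218_i, ThetaEnvTower.Cor219_iii, IsEtThOrigin, hYcl}: (ii)+(iii) by `prop15_ii_iii_modelSystem_of_origin`;
  (i) as printed ("uniquely determined, up to isomorphism, by `X̲̲_k`": every compatible system over the model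
  family is isomorphic to the NATURAL one, `Prop15_i (modelSystem …) B`) by abc-iut-w4-d030's `prop15_i'_etaleLevels`
  at the pair `(modelSystem, B)` (the natural system qualifying by `isMonoThetaCompatible_modelSystem`); (i)′ by
  `prop15_i'_of_cyclotomeTower` — both with their [EtTh] Cor. 2.18 (iv) inputs supplied by
  `thetaEnvData_cor218_iv_surjective_modAll` / `thetaEnvData_cor218_iv_fibre_of_origin`;
* `ThetaSetting.isMonoThetaEnv_iff_ofDoubleUnderline_of_H2` / `_of_tower` / `_modAll` — bridge B8 part 3's
  `isMonoThetaEnv_iff_ofDoubleUnderline` ("t2's `IsMonoThetaEnv` = underlies an [IUTchII]-typed `MonoThetaEnv` of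
  `ofDoubleUnderline`") with its by-name input [EtTh] Cor. 2.18 (ii) (`ThetaEnvData.Cor218_ii`) SUPPLIED by
  abc-iut-L2-t10's model theorems `rigidData_cor218_ii_of_H2` (one level, 2-torsion hypothesis `H2`),
  `rigidData_cor218_ii` (every level of a compatible cyclotome tower), `rigidData_cor218_ii_modAll` (every
  `M ∈ ℕ≥1`) — i.e. modulo Prop. 1.5 (ii), (iii) of [EtTh] §1 only. [cite: MochizukiEtTh2009, Cor 2.18(ii) p.60]
-/

noncomputable section

namespace Literature.IUT.HodgeArakelov

open Literature.AnabelianGeometry.EtaleTheta Literature.AnabelianGeometry.SemiGraphs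
open scoped Literature.AnabelianGeometry.EtaleTheta

namespace EtaleLevels

variable {p : ℕ} [Fact p.Prime] {D : Literature.AnabelianGeometry.EtaleTheta.ThetaSetting p}
  {E : D.EtaleThetaData} {l : ℕ} (C : E.DoubleUnderline l) (hC : D.Compat) (hS : D.Sec2Hyps)
  (hl : l.Prime) (hp2 : p ≠ 2) (hpl : p ≠ l) (hζ : ∃ ζ : D.K, IsPrimitiveRoot ζ (4 * l))
  {Es : Set ℕ+} (τ : D.CyclotomeTower l Es)
  (f : contCocycles D.toTheta D.DeltaTheta C.GtpYdduu) (hf : f ∈ C.rootCocycles hC)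

/-- **[IUTchII] Prop. 1.5 (ii)+(iii) for the natural system of `X̲̲_K`, modulo the FACT-LIST inputs** (abc-iut-L6-t1's
`Prop15_ii_iii (modelSystem …)`): abc-iut-w4-d030's `prop15_ii_iii_modelSystem_of_cor218_i'` with [EtTh] Cor. 2.18 (i)
granted at the chain levels of `τ` (transported to every `τ.modAll M`, the clause being level-free) and with the
[EtTh] Cor. 2.18 (iv) surjectivity at EVERY `M ∈ ℕ≥1` supplied by layer L2 from Cor. 2.18 (i) + `ThetaEnvTower.Cor219_iii`
+ Prop. 1.5 (ii), (iii). Remaining inputs: Prop. 1.5 (iii) (`h15`), the cusp labels `L`, and the natural system's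
`hZ` (discharged in the `_of_origin` form). [claim: Mochizuki2012, status: disputed] (IUTchII §1 Prop 1.5 (iii), kurims pp.29-30) -/
theorem prop15_ii_iii_modelSystem_of_facts
    (h15 : Literature.AnabelianGeometry.EtaleTheta.ThetaSetting.Prop15iii E hC)
    (h15ii : Literature.AnabelianGeometry.EtaleTheta.ThetaSetting.Prop15ii E.toKummerData hC)
    (L : C.CuspLabels)
    (hZ : ∀ M : ℕ+, Nonempty (ModelCyclotomes.lDeltaQuot (C.rigidData (τ.modAll M) hC hS h15 L) ≃*
      Literature.IUT.HodgeTheaters.ZHat))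
    (h218i : ∀ e : Es, (C.rigidData (τ.mod e) hC hS h15 L).Cor218_i)
    (h219iii : (C.thetaEnvTower τ hC hS).Cor219_iii) :
    Literature.IUT.HodgeArakelov.Prop15_ii_iii
      (modelSystem C hC hS hl hp2 hpl hζ τ.modAll f hf τ.red_modAll h15 L hZ) :=
  prop15_ii_iii_modelSystem_of_cor218_i' C hC hS hl hp2 hpl hζ τ.modAll f hf τ.red_modAll h15 L hZ
    (fun M => C.rigidData_cor218_i_of_level (τ.mod ⟨1, τ.one_mem⟩) (τ.modAll M) hC hS h15 L
      (h218i ⟨1, τ.one_mem⟩))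
    (fun M => C.thetaEnvData_cor218_iv_surjective_modAll τ M hC hS h15 h15ii L h218i h219iii)

/-- **[IUTchII] Prop. 1.5 (ii)+(iii) for the natural system of `X̲̲_K`, origin form**: as
`prop15_ii_iii_modelSystem_of_facts`, with `hZ` ("`(l·Δ_Θ)(M) ≅ Ẑ`", [EtTh] p. 12; GAP-LEDGER G-w4d021-1) supplied at
every level by abc-iut-L2-d1's THEOREM `ModelCyclotomes.nonempty_lDeltaQuot_rigidData_mulEquiv_zHat`
(⟸ `IsEtThOrigin`, `hYcl`). Binder list: Prop. 1.5 (ii), (iii), `L`, Cor. 2.18 (i) at the chain levels,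
`ThetaEnvTower.Cor219_iii`, `IsEtThOrigin`, `hYcl`. [claim: Mochizuki2012, status: disputed] (IUTchII §1 Prop 1.5 (iii), kurims pp.29-30) -/
theorem prop15_ii_iii_modelSystem_of_origin
    (h15 : Literature.AnabelianGeometry.EtaleTheta.ThetaSetting.Prop15iii E hC)
    (h15ii : Literature.AnabelianGeometry.EtaleTheta.ThetaSetting.Prop15ii E.toKummerData hC)
    (L : C.CuspLabels)
    (h218i : ∀ e : Es, (C.rigidData (τ.mod e) hC hS h15 L).Cor218_i)
    (h219iii : (C.thetaEnvTower τ hC hS).Cor219_iii) (hO : D.IsEtThOrigin)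
    (hYcl : (D.DtpY.map D.toHat.toMonoidHom).topologicalClosure ≤
      D.DtpY.map D.toHat.toMonoidHom ⊔ (⁅⁅D.DeltaHat, D.DeltaHat⁆, D.DeltaHat⁆).topologicalClosure) :
    Literature.IUT.HodgeArakelov.Prop15_ii_iii
      (modelSystem C hC hS hl hp2 hpl hζ τ.modAll f hf τ.red_modAll h15 L (fun M =>
        ModelCyclotomes.nonempty_lDeltaQuot_rigidData_mulEquiv_zHat C (τ.modAll M) hC hS h15 L hO hYcl
          hl.ne_zero)) :=
  prop15_ii_iii_modelSystem_of_facts C hC hS hl hp2 hpl hζ τ f hf h15 h15ii L _ h218i h219iii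

/-- **[IUTchII] Prop. 1.5 (iii) alone for the natural system of `X̲̲_K`, origin form**: the `θ_env` data (exterior
cyclotomes, the limit cyclotomic rigidity isomorphism — an isomorphism by abc-iut-w4-d030's `bijective_rigidLimHom`
— and `θ_env`) EXIST, i.e. `Nonempty (ThetaEnvData modelSystem)`, modulo Prop. 1.5 (iii), the cusp labels, [EtTh]
Cor. 2.18 (i) at the chain level `1` (which yields abc-iut-w4-d013's `PiYddCharacteristic C`), `IsEtThOrigin` and
`hYcl` (for `hZ`). [claim: Mochizuki2012, status: disputed] (IUTchII §1 Prop 1.5 (iii), kurims pp.29-30) -/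
theorem nonempty_thetaEnvData_of_origin
    (h15 : Literature.AnabelianGeometry.EtaleTheta.ThetaSetting.Prop15iii E hC) (L : C.CuspLabels)
    (h218i₁ : (C.rigidData (τ.mod ⟨1, τ.one_mem⟩) hC hS h15 L).Cor218_i) (hO : D.IsEtThOrigin)
    (hYcl : (D.DtpY.map D.toHat.toMonoidHom).topologicalClosure ≤
      D.DtpY.map D.toHat.toMonoidHom ⊔ (⁅⁅D.DeltaHat, D.DeltaHat⁆, D.DeltaHat⁆).topologicalClosure) :
    Nonempty (ThetaEnvData
      (modelSystem C hC hS hl hp2 hpl hζ τ.modAll f hf τ.red_modAll h15 L (fun M =>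
        ModelCyclotomes.nonempty_lDeltaQuot_rigidData_mulEquiv_zHat C (τ.modAll M) hC hS h15 L hO hYcl
          hl.ne_zero))) :=
  nonempty_thetaEnvData C hC hS hl hp2 hpl hζ τ.modAll f hf τ.red_modAll h15 L _
    (EtaleThetaDataOfSetting.piYddCharacteristic_of_cor218_i C (τ.mod ⟨1, τ.one_mem⟩) hC hS h15 L _ rfl
      h218i₁)
    (bijective_rigidLimHom C hC hS hl hp2 hpl hζ τ.modAll f hf τ.red_modAll h15 L _)

/-! ## v2: named transport of Cor. 2.18 (i); the whole node under one binder list -/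

/-- **[EtTh] Cor. 2.18 (i) at EVERY level `M ∈ ℕ≥1` (identifications `τ.modAll`) from Cor. 2.18 (i) at the chain
levels** — indeed from the single chain level `1 ∈ E`: the statement `RigidData.Cor218_i` for abc-iut-L2-t8's
instantiated rigidity data does not involve the cyclotome identification (`rigidData_cor218_i_of_level`). This is
the hypothesis `h218i` of `prop15_ii_iii_modelSystem_of_cor218_i'` / `transitionsAreIsos_modelSystem_of_cor218_i`.
[cite: MochizukiEtTh2009, Cor 2.18(i) p.60] -/
theorem cor218_i_modAll_of_chain
    (h15 : Literature.AnabelianGeometry.EtaleTheta.ThetaSetting.Prop15iii E hC) (L : C.CuspLabels)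
    (h218i : ∀ e : Es, (C.rigidData (τ.mod e) hC hS h15 L).Cor218_i) (M : ℕ+) :
    (C.rigidData (τ.modAll M) hC hS h15 L).Cor218_i :=
  C.rigidData_cor218_i_of_level (τ.mod ⟨1, τ.one_mem⟩) (τ.modAll M) hC hS h15 L (h218i ⟨1, τ.one_mem⟩)

/-- **[IUTchII] Prop. 1.5 (i) (printed form), (i)′, (ii) and (iii) for the genuine [EtTh] model family of `X̲̲_K`,
under ONE binder list** = the FACT-LIST inputs of abc-iut-L2-d1's [EtTh] Cor. 2.19 (ii) model discharge: Prop. 1.5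
(ii), (iii) of [EtTh] §1, the cusp labels `L`, temp-slimness of `Π^tp_X` ([SemiAnbd] Ex. 3.10), `IsOpenMap D.aug`,
[EtTh] Cor. 2.18 (i) at every chain level (FACT-policy anabelian input), `ThetaEnvTower.Cor219_iii` (constant
multiple rigidity in tower form), and the §1 origin hypotheses `IsEtThOrigin` ("`Δ_X` profinite free on two
generators", [EtTh] p. 12), `hYcl` ("`(Δ^tp_Y)^Θ` … profinite", p. 12). Conjuncts: (ii)+(iii) `Prop15_ii_iii` of the
natural system (`prop15_ii_iii_modelSystem_of_origin`); (i) as printed — "uniquely determined, up to isomorphism,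
by `X̲̲_k`": every projective system over the model family whose transitions are morphisms of mono-theta
environments is isomorphic to the NATURAL one (abc-iut-w4-d030's `prop15_i'_etaleLevels` at the pair
`(modelSystem, B)`, the natural system qualifying by `isMonoThetaCompatible_modelSystem`; [EtTh] Cor. 2.18 (iv)
inputs supplied by `thetaEnvData_cor218_iv_surjective_modAll` / `thetaEnvData_cor218_iv_fibre_of_origin`); (i)′ —
any two compatible systems are compatibly isomorphic (`prop15_i'_of_cyclotomeTower`, same inputs).
[claim: Mochizuki2012, status: disputed] (IUTchII §1 Prop 1.5, kurims pp.29-30) [cite: MochizukiEtTh2009, Cor 2.19(ii) p.64] -/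
theorem prop15_i_i'_ii_iii_modelSystem_of_origin
    (hslimX : Literature.AlgebraicGeometry.Frobenioids.IsSlimGroup D.PiTemp) (haugOpen : IsOpenMap D.aug)
    (h15 : Literature.AnabelianGeometry.EtaleTheta.ThetaSetting.Prop15iii E hC)
    (h15ii : Literature.AnabelianGeometry.EtaleTheta.ThetaSetting.Prop15ii E.toKummerData hC)
    (L : C.CuspLabels)
    (h218i : ∀ e : Es, (C.rigidData (τ.mod e) hC hS h15 L).Cor218_i)
    (h219iii : (C.thetaEnvTower τ hC hS).Cor219_iii) (hO : D.IsEtThOrigin)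
    (hYcl : (D.DtpY.map D.toHat.toMonoidHom).topologicalClosure ≤
      D.DtpY.map D.toHat.toMonoidHom ⊔ (⁅⁅D.DeltaHat, D.DeltaHat⁆, D.DeltaHat⁆).topologicalClosure) :
    Literature.IUT.HodgeArakelov.Prop15_ii_iii
        (modelSystem C hC hS hl hp2 hpl hζ τ.modAll f hf τ.red_modAll h15 L (fun M =>
          ModelCyclotomes.nonempty_lDeltaQuot_rigidData_mulEquiv_zHat C (τ.modAll M) hC hS h15 L hO hYcl
            hl.ne_zero)) ∧
      (∀ (B : MonoThetaProjSystem (modelFamily C hC hS hl hp2 hpl hζ τ.modAll f hf)),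
        B.IsMonoThetaCompatible (reductions C hC hS hl hp2 hpl hζ τ.modAll f hf τ.red_modAll hslimX) →
        Prop15_i (modelSystem C hC hS hl hp2 hpl hζ τ.modAll f hf τ.red_modAll h15 L (fun M =>
          ModelCyclotomes.nonempty_lDeltaQuot_rigidData_mulEquiv_zHat C (τ.modAll M) hC hS h15 L hO hYcl
            hl.ne_zero)) B) ∧
      ∀ (A B : MonoThetaProjSystem (modelFamily C hC hS hl hp2 hpl hζ τ.modAll f hf)),
        Literature.IUT.HodgeArakelov.Prop15_i'
          (reductions C hC hS hl hp2 hpl hζ τ.modAll f hf τ.red_modAll hslimX) A B :=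
  ⟨prop15_ii_iii_modelSystem_of_origin C hC hS hl hp2 hpl hζ τ f hf h15 h15ii L h218i h219iii hO hYcl,
    fun B hB => prop15_i'_etaleLevels C hC hS hl hp2 hpl hζ τ.modAll f hf τ.red_modAll hslimX haugOpen
      (fun M => C.thetaEnvData_cor218_iv_surjective_modAll τ M hC hS h15 h15ii L h218i h219iii)
      (fun M => C.thetaEnvData_cor218_iv_fibre_of_origin (τ.modAll M) hC hS h15 L hO hYcl) _ B
      (isMonoThetaCompatible_modelSystem C hC hS hl hp2 hpl hζ τ.modAll f hf τ.red_modAll h15 L _ hslimX) hB,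
    fun A B => prop15_i'_of_cyclotomeTower C hC hS hl hp2 hpl hζ τ f hf hslimX haugOpen
      (fun M => C.thetaEnvData_cor218_iv_surjective_modAll τ M hC hS h15 h15ii L h218i h219iii)
      (fun M => C.thetaEnvData_cor218_iv_fibre_of_origin (τ.modAll M) hC hS h15 L hO hYcl) A B⟩

end EtaleLevels

/-! ## v2: bridge B8 part 3 at the model — the Cor. 2.18 (ii) input supplied -/

namespace ThetaSetting

variable {p : ℕ} [Fact p.Prime] {D : Literature.AnabelianGeometry.EtaleTheta.ThetaSetting p}
  {E : D.EtaleThetaData} {l : ℕ} (C : E.DoubleUnderline l) (hC : D.Compat) (hS : D.Sec2Hyps)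
  (hl : l.Prime) (hp2 : p ≠ 2) (hpl : p ≠ l) (hζ : ∃ ζ : D.K, IsPrimitiveRoot ζ (4 * l))

/-- **Bridge B8 part 3 with its Cor. 2.18 (ii) input supplied, single level**: for abc-iut-L2-t8's `ThetaEnvData`
of the Tate curve at a level-`N` identification `μ` under which the `2`-torsion of `l·Δ_Θ` dies in `μ_N` (`H2`;
automatic for `N` odd), t2's `IsMonoThetaEnv` = "underlies an [IUTchII]-typed `MonoThetaEnv` of
`ofDoubleUnderline`" — abc-iut-L6's `isMonoThetaEnv_iff_ofDoubleUnderline` with `ThetaEnvData.Cor218_ii` replaced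
by abc-iut-L2-t10's THEOREM `rigidData_cor218_ii_of_H2` (⟸ Prop. 1.5 (ii), (iii) of [EtTh] §1, `H2`).
[cite: MochizukiEtTh2009, Cor 2.18(ii) p.60] -/
theorem isMonoThetaEnv_iff_ofDoubleUnderline_of_H2 {N : ℕ+} (μ : D.CyclotomeMod l N)
    (h15 : Literature.AnabelianGeometry.EtaleTheta.ThetaSetting.Prop15iii E hC)
    (h15ii : Literature.AnabelianGeometry.EtaleTheta.ThetaSetting.Prop15ii E.toKummerData hC)
    (L : C.CuspLabels) (H2 : ∀ t : D.lDeltaTheta l, t ^ 2 = 1 → μ.red t = 1)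
    {η : (C.thetaEnvData μ hC hS).PiYdd → MuN p N} (hη : η ∈ (C.thetaEnvData μ hC hS).thetaCocycles)
    (M' : Literature.AnabelianGeometry.EtaleTheta.MonoThetaEnv.{0}) :
    (C.thetaEnvData μ hC hS).IsMonoThetaEnv M' ↔
      ∃ M : MonoThetaEnv (ofDoubleUnderline C μ hC hS hl hp2 hpl hζ hη), M.toEtale = M' :=
  isMonoThetaEnv_iff_ofDoubleUnderline C μ hC hS hl hp2 hpl hζ hη
    ((RigidData.cor218_ii_iff _).1 (C.rigidData_cor218_ii_of_H2 μ hC hS h15 h15ii L H2)) M'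

variable {Es : Set ℕ+} (τ : D.CyclotomeTower l Es)

/-- **Bridge B8 part 3 with its Cor. 2.18 (ii) input supplied, at every level of a compatible cyclotome tower**
(abc-iut-L2-t8's `CyclotomeTower`; the `2`-torsion hypothesis is automatic there,
`CyclotomeTower.red_eq_one_of_sq_eq_one`): modulo Prop. 1.5 (ii), (iii) of [EtTh] §1 only.
[cite: MochizukiEtTh2009, Cor 2.18(ii) p.60] -/
theorem isMonoThetaEnv_iff_ofDoubleUnderline_of_tower (e : Es)
    (h15 : Literature.AnabelianGeometry.EtaleTheta.ThetaSetting.Prop15iii E hC)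
    (h15ii : Literature.AnabelianGeometry.EtaleTheta.ThetaSetting.Prop15ii E.toKummerData hC)
    (L : C.CuspLabels)
    {η : (C.thetaEnvData (τ.mod e) hC hS).PiYdd → MuN p e} (hη : η ∈ (C.thetaEnvData (τ.mod e) hC hS).thetaCocycles)
    (M' : Literature.AnabelianGeometry.EtaleTheta.MonoThetaEnv.{0}) :
    (C.thetaEnvData (τ.mod e) hC hS).IsMonoThetaEnv M' ↔
      ∃ M : MonoThetaEnv (ofDoubleUnderline C (τ.mod e) hC hS hl hp2 hpl hζ hη), M.toEtale = M' :=
  isMonoThetaEnv_iff_ofDoubleUnderline C (τ.mod e) hC hS hl hp2 hpl hζ hη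
    ((RigidData.cor218_ii_iff _).1 (C.rigidData_cor218_ii τ e hC hS h15 h15ii L)) M'

/-- **Bridge B8 part 3 with its Cor. 2.18 (ii) input supplied, at EVERY level `M ∈ ℕ≥1`** (the all-level
identifications `τ.modAll M` of abc-iut-w4-d024, the levels of the natural projective system
`EtaleLevels.modelSystem`): modulo Prop. 1.5 (ii), (iii) of [EtTh] §1 only (`rigidData_cor218_ii_modAll`).
[cite: MochizukiEtTh2009, Cor 2.18(ii) p.60] -/
theorem isMonoThetaEnv_iff_ofDoubleUnderline_modAll (M : ℕ+)
    (h15 : Literature.AnabelianGeometry.EtaleTheta.ThetaSetting.Prop15iii E hC)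
    (h15ii : Literature.AnabelianGeometry.EtaleTheta.ThetaSetting.Prop15ii E.toKummerData hC)
    (L : C.CuspLabels)
    {η : (C.thetaEnvData (τ.modAll M) hC hS).PiYdd → MuN p M}
    (hη : η ∈ (C.thetaEnvData (τ.modAll M) hC hS).thetaCocycles)
    (M' : Literature.AnabelianGeometry.EtaleTheta.MonoThetaEnv.{0}) :
    (C.thetaEnvData (τ.modAll M) hC hS).IsMonoThetaEnv M' ↔
      ∃ M₀ : MonoThetaEnv (ofDoubleUnderline C (τ.modAll M) hC hS hl hp2 hpl hζ hη), M₀.toEtale = M' :=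
  isMonoThetaEnv_iff_ofDoubleUnderline C (τ.modAll M) hC hS hl hp2 hpl hζ hη
    ((RigidData.cor218_ii_iff _).1 (C.rigidData_cor218_ii_modAll τ M hC hS h15 h15ii L)) M'

end ThetaSetting

end Literature.IUT.HodgeArakelov

end
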